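import Summits.ValiantsHypothesis.ValiantsHypothesis.Theorems.LacunarySymmetroidMatrixDescartesDoorA26WallBubblingExpSumLocalSigns
import Mathlib.Analysis.Calculus.LHopital

/-!
# `DoorA26` / line `wall_bubbling` — SCALING LIMITS at a multiple zero (Taylor quotients of exponential sums; the blow-up `t⋆ + η^α σ`)

HONEST FRAMING.  Object-search cell `pub-symmetroid`, crux `Theses.LacunarySymmetroid.DoorA26` (stmt-ValiantsHypothesis-19979; OPEN, typed,
never asserted).  W2 seat val-sym-door-p1 g19, file #70; def-free helper for obligation (R) of `Cruxes/DoorA26/Lines/wall_bubbling.lean`, the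
analytic back-end of the EVENTUAL-SIGNS LIFT FORMAT (#69 `…EventualSigns`): every opening of a multiple zero `t⋆` by a family
`F_η(t) = Σ_i η^{e_i} c_i(t)` (the `c_i` are the `η`-coefficients of `det(P + ηQ₁ + η²Q₂ + …)`, exponential sums in `t`) is decided by the
signs of the SCALING POLYNOMIAL `M(σ) = Σ_{e_i + αk_i = β} A_i σ^{k_i}` at the moving abscissae `t⋆ + η^α σ`, where `c_i(t⋆ + h) ~ A_i h^{k_i}`
(memo `DOOR-A26-P1G19-NO-BALANCE.md` §7d/§7g: order 3 ↔ `aσ³ + 2π₁′σ`, order 4 ↔ `aσ⁴ + 2π₂σ² + e₀`).  Imports #56 `…ExpSumLocalSigns`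
(`continuous_expSum`, `hasDerivAt_expSum`) and Mathlib's L'Hôpital rule.

WHAT IS HERE.  ★ `tendsto_expSum_div_pow` (TAYLOR QUOTIENT: if `f = expSum a x` has `f^{(j)}(z) = 0` for `j < k` then
`f(z + h)/h^k → f^{(k)}(z)/k!` as `h → 0`, `h ≠ 0`; induction by L'Hôpital); `tendsto_rpow_nhdsGT_zero`, `tendsto_rpow_mul_nhdsGT`;
★ `tendsto_scaling_sum` (the blow-up limit `η^{-β} Σ_i η^{e_i} c_i(η^α σ) → M(σ)` for `β = min_i (e_i + αk_i)`, real exponents, `σ ≠ 0`);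
`eventually_kappa_pos_rpow_mul` and ★ `eventually_kappa_pos_scaling` (`κ M(σ) > 0 ⇒ κ F_η(t⋆ + η^ασ) > 0` eventually) — exactly the
hypothesis `hsign` of #69 at a moving abscissa.  Nothing here bears on `DoorA26`, `DoorA34`, (W)/(M)/(R), `MatrixDescartes` (18050) or
`VP ≠ VNP`; registers unchanged.

[folklore] Taylor / L'Hôpital; Newton-polygon scaling.  [this work] the packaging.
-/

set_option linter.dupNamespace false

namespace Summit.ValiantsHypothesis.ValiantsHypothesis.Theorems.LacunarySymmetroidMatrixDescartes.WallBubbling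

open Finset Filter Topology
open Bubbling (expSum hasDerivAt_expSum)

/-- Continuity of `h ↦ f(z + h)` at `0` for an exponential sum. [folklore] -/
theorem tendsto_expSum_comp_add {ι : Type*} [Fintype ι] (a x : ι → ℝ) (z : ℝ) :
    Tendsto (fun h => expSum a x (z + h)) (𝓝 0) (𝓝 (expSum a x z)) := by
  have h := ((continuous_expSum a x).comp (continuous_const.add continuous_id) :
    Continuous fun h : ℝ => expSum a x (z + h)).continuousAt (x := (0 : ℝ))
  simpa [ContinuousAt, Function.comp_def] using h

/-- ★ **TAYLOR QUOTIENT of an exponential sum at a zero of order `≥ k`.**  If `f = expSum a x` satisfies `f^{(j)}(z) = 0` for `j < k`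
(derivatives as the sums with coefficients `a_i x_i^j`), then `f(z + h)/h^k → f^{(k)}(z)/k!` as `h → 0`, `h ≠ 0`. [folklore] -/
theorem tendsto_expSum_div_pow {ι : Type*} [Fintype ι] (x : ι → ℝ) (z : ℝ) : ∀ (k : ℕ) (a : ι → ℝ),
    (∀ j < k, expSum (fun i => a i * x i ^ j) x z = 0) →
    Tendsto (fun h => expSum a x (z + h) / h ^ k) (𝓝[≠] 0)
      (𝓝 (expSum (fun i => a i * x i ^ k) x z / k.factorial)) := by
  intro k
  induction k with
  | zero =>
    intro a _
    simp only [pow_zero, div_one, Nat.factorial_zero, Nat.cast_one, mul_one]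
    exact (tendsto_expSum_comp_add a x z).mono_left nhdsWithin_le_nhds
  | succ k ih =>
    intro a hvan
    have hshift : ∀ j, (fun i => (fun i => a i * x i) i * x i ^ j) = fun i => a i * x i ^ (j + 1) :=
      fun j => funext fun i => by ring
    have ih' := ih (fun i => a i * x i) (fun j hj => by rw [hshift]; exact hvan (j + 1) (by omega))
    rw [hshift] at ih'
    have hz : expSum a x z = 0 := by simpa using hvan 0 (Nat.succ_pos k)
    have hff' : ∀ᶠ h in 𝓝[≠] (0 : ℝ),
        HasDerivAt (fun h => expSum a x (z + h)) (expSum (fun i => a i * x i) x (z + h)) h :=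
      Filter.Eventually.of_forall fun h => by
        have := (hasDerivAt_expSum a x (z + h)).comp h ((hasDerivAt_id h).const_add z)
        simpa [Function.comp_def] using this
    have hgg' : ∀ᶠ h in 𝓝[≠] (0 : ℝ), HasDerivAt (fun h : ℝ => h ^ (k + 1)) (((k : ℝ) + 1) * h ^ k) h :=
      Filter.Eventually.of_forall fun h => by
        have := hasDerivAt_pow (k + 1) h
        simpa using this
    have hg' : ∀ᶠ h in 𝓝[≠] (0 : ℝ), ((k : ℝ) + 1) * h ^ k ≠ 0 := by
      filter_upwards [self_mem_nhdsWithin] with h hh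
      exact mul_ne_zero (by positivity) (pow_ne_zero _ hh)
    have hfa : Tendsto (fun h => expSum a x (z + h)) (𝓝[≠] 0) (𝓝 0) := by
      have hc := tendsto_expSum_comp_add a x z
      rw [hz] at hc
      exact hc.mono_left nhdsWithin_le_nhds
    have hga : Tendsto (fun h : ℝ => h ^ (k + 1)) (𝓝[≠] 0) (𝓝 0) := by
      have : Tendsto (fun h : ℝ => h ^ (k + 1)) (𝓝 0) (𝓝 ((0 : ℝ) ^ (k + 1))) := (continuous_pow (k + 1)).tendsto 0
      rw [zero_pow (Nat.succ_ne_zero k)] at this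
      exact this.mono_left nhdsWithin_le_nhds
    have hdiv : Tendsto (fun h => expSum (fun i => a i * x i) x (z + h) / (((k : ℝ) + 1) * h ^ k)) (𝓝[≠] 0)
        (𝓝 (expSum (fun i => a i * x i ^ (k + 1)) x z / (k + 1).factorial)) := by
      have heq : (fun h => expSum (fun i => a i * x i) x (z + h) / (((k : ℝ) + 1) * h ^ k))
          = fun h => (expSum (fun i => a i * x i) x (z + h) / h ^ k) / ((k : ℝ) + 1) :=
        funext fun h => by rw [mul_comm ((k : ℝ) + 1), div_div]
      rw [heq]
      have := ih'.div_const ((k : ℝ) + 1)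
      convert this using 2
      rw [Nat.factorial_succ, Nat.cast_mul, Nat.cast_succ, div_div, mul_comm]
    exact HasDerivAt.lhopital_zero_nhdsNE hff' hgg' hg' hfa hga hdiv

/-- `η^γ → 0` as `η → 0⁺` for `γ > 0` (real power). [folklore] -/
theorem tendsto_rpow_nhdsGT_zero {γ : ℝ} (hγ : 0 < γ) : Tendsto (fun η : ℝ => η ^ γ) (𝓝[>] 0) (𝓝 0) := by
  have h := (Real.continuousAt_rpow_const 0 γ (Or.inr hγ.le)).tendsto
  rw [Real.zero_rpow hγ.ne'] at h
  exact h.mono_left nhdsWithin_le_nhds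

/-- The scaled abscissa `η^α σ` tends to `0` through non-zero values as `η → 0⁺` (`α > 0`, `σ ≠ 0`). [folklore] -/
theorem tendsto_rpow_mul_nhdsGT {α : ℝ} (hα : 0 < α) {σ : ℝ} (hσ : σ ≠ 0) :
    Tendsto (fun η : ℝ => η ^ α * σ) (𝓝[>] 0) (𝓝[≠] 0) := by
  refine tendsto_nhdsWithin_iff.2 ⟨?_, ?_⟩
  · have := (tendsto_rpow_nhdsGT_zero hα).mul_const σ
    simpa using this
  · filter_upwards [self_mem_nhdsWithin] with η hη
    exact mul_ne_zero (Real.rpow_pos_of_pos hη α).ne' hσ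

/-- ★ **SCALING LIMIT (Newton polygon).**  Terms `η^{e_i} c_i(t)` with `c_i(h)/h^{k_i} → A_i` (`h → 0`, `h ≠ 0`); blow-up `t = η^α σ`,
`α > 0`, `σ ≠ 0`; for any `β ≤ e_i + α k_i` (all `i`): `η^{-β} Σ_i η^{e_i} c_i(η^α σ) → Σ_{e_i + αk_i = β} A_i σ^{k_i}` as `η → 0⁺`. [folklore] -/
theorem tendsto_scaling_sum {ι : Type*} [Fintype ι] (c : ι → ℝ → ℝ) (e : ι → ℝ) (k : ι → ℕ) (A : ι → ℝ)
    {α : ℝ} (hα : 0 < α) {σ : ℝ} (hσ : σ ≠ 0)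
    (hc : ∀ i, Tendsto (fun h => c i h / h ^ (k i)) (𝓝[≠] 0) (𝓝 (A i))) (β : ℝ) (hβ : ∀ i, β ≤ e i + α * k i) :
    Tendsto (fun η : ℝ => (∑ i, η ^ (e i) * c i (η ^ α * σ)) / η ^ β) (𝓝[>] 0)
      (𝓝 (∑ i, if e i + α * k i = β then A i * σ ^ (k i) else 0)) := by
  classical
  -- rewrite each term for `η > 0`
  have hre : ∀ η : ℝ, 0 < η → (∑ i, η ^ (e i) * c i (η ^ α * σ)) / η ^ β
      = ∑ i, η ^ (e i + α * k i - β) * (σ ^ (k i) * (c i (η ^ α * σ) / (η ^ α * σ) ^ (k i))) := by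
    intro η hη
    rw [Finset.sum_div]
    refine Finset.sum_congr rfl fun i _ => ?_
    have hh : η ^ α * σ ≠ 0 := mul_ne_zero (Real.rpow_pos_of_pos hη α).ne' hσ
    have hpow : (η ^ α * σ) ^ (k i) = η ^ (α * k i) * σ ^ (k i) := by
      rw [mul_pow, ← Real.rpow_natCast (η ^ α) (k i), ← Real.rpow_mul hη.le]
    have hsplit : η ^ (e i + α * k i - β) = η ^ (e i) * η ^ (α * k i) / η ^ β := by
      rw [Real.rpow_sub hη, Real.rpow_add hη]
    rw [hsplit, hpow]
    have hσk : σ ^ (k i) ≠ 0 := pow_ne_zero _ hσ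
    have hηk : η ^ (α * k i) ≠ 0 := (Real.rpow_pos_of_pos hη _).ne'
    field_simp
  have hcong : (fun η : ℝ => (∑ i, η ^ (e i) * c i (η ^ α * σ)) / η ^ β) =ᶠ[𝓝[>] 0]
      fun η => ∑ i, η ^ (e i + α * k i - β) * (σ ^ (k i) * (c i (η ^ α * σ) / (η ^ α * σ) ^ (k i))) := by
    filter_upwards [self_mem_nhdsWithin] with η hη
    exact hre η hη
  refine Tendsto.congr' hcong.symm <| tendsto_finsetSum _ fun i _ => ?_
  -- the quotient factor tends to `A_i`
  have hq : Tendsto (fun η : ℝ => c i (η ^ α * σ) / (η ^ α * σ) ^ (k i)) (𝓝[>] 0) (𝓝 (A i)) :=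
    (hc i).comp (tendsto_rpow_mul_nhdsGT hα hσ)
  -- the power factor tends to `1` or `0`
  rcases eq_or_lt_of_le (hβ i) with h | h
  · have hγ : e i + α * k i - β = 0 := by rw [← h]; ring
    rw [if_pos h.symm, hγ]
    simp only [Real.rpow_zero, one_mul]
    have := hq.const_mul (σ ^ (k i))
    simpa [mul_comm] using this
  · have hγ : 0 < e i + α * k i - β := by linarith
    rw [if_neg (ne_of_gt h)]
    have := (tendsto_rpow_nhdsGT_zero hγ).mul (hq.const_mul (σ ^ (k i)))
    simpa using this

/-- The eventual-sign helper with a real power: `g → L` along `η → 0⁺`, `κL > 0` ⇒ `κ · (η^β g(η)) > 0` eventually. [folklore] -/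
theorem eventually_kappa_pos_rpow_mul {g : ℝ → ℝ} {L κ : ℝ} (β : ℝ) (hg : Tendsto g (𝓝[>] 0) (𝓝 L)) (hκ : 0 < κ * L) :
    ∀ᶠ η in 𝓝[>] (0 : ℝ), 0 < κ * (η ^ β * g η) := by
  have h1 : ∀ᶠ η in 𝓝[>] (0 : ℝ), 0 < κ * g η := (hg.const_mul κ).eventually (eventually_gt_nhds hκ)
  have h2 : ∀ᶠ η in 𝓝[>] (0 : ℝ), 0 < η := eventually_mem_nhdsWithin
  filter_upwards [h1, h2] with η hη hpos
  have : κ * (η ^ β * g η) = η ^ β * (κ * g η) := by ring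
  rw [this]
  exact mul_pos (Real.rpow_pos_of_pos hpos β) hη

/-- ★ **EVENTUAL SIGN AT A MOVING ABSCISSA.**  Under the hypotheses of `tendsto_scaling_sum`, if the scaling polynomial
`M(σ) = Σ_{e_i + αk_i = β} A_i σ^{k_i}` has `κ M(σ) > 0`, then `κ · Σ_i η^{e_i} c_i(η^α σ) > 0` for all small `η > 0` — the hypothesis `hsign`
of #69 `mem_twentyLocus_of_eventually_alternating` at the abscissa `t⋆ + η^α σ` (after translating `t⋆` to `0`). [this work] -/
theorem eventually_kappa_pos_scaling {ι : Type*} [Fintype ι] (c : ι → ℝ → ℝ) (e : ι → ℝ) (k : ι → ℕ) (A : ι → ℝ)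
    {α : ℝ} (hα : 0 < α) {σ : ℝ} (hσ : σ ≠ 0)
    (hc : ∀ i, Tendsto (fun h => c i h / h ^ (k i)) (𝓝[≠] 0) (𝓝 (A i))) (β : ℝ) (hβ : ∀ i, β ≤ e i + α * k i)
    (κ : ℝ) (hκ : 0 < κ * ∑ i, if e i + α * k i = β then A i * σ ^ (k i) else 0) :
    ∀ᶠ η in 𝓝[>] (0 : ℝ), 0 < κ * ∑ i, η ^ (e i) * c i (η ^ α * σ) := by
  have h := eventually_kappa_pos_rpow_mul β (tendsto_scaling_sum c e k A hα hσ hc β hβ) hκ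
  have hpos : ∀ᶠ η in 𝓝[>] (0 : ℝ), 0 < η := eventually_mem_nhdsWithin
  filter_upwards [h, hpos] with η hη hη0
  have hne : η ^ β ≠ 0 := (Real.rpow_pos_of_pos hη0 β).ne'
  rwa [mul_div_cancel₀ _ hne] at hη

end Summit.ValiantsHypothesis.ValiantsHypothesis.Theorems.LacunarySymmetroidMatrixDescartes.WallBubbling
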